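import Summits.Ventures.PercRepro.Night2LocalD2CoverPairDefs

/-!
# PercRepro — two far preimages kill the covering preimages (night-2, gen 14)

The first structural lemma of the pair-5 programme for the (6,4) cell `|E ∖ G| = 2` (proofs/NIGHT-2-d2.md §0, §3): at a
shadow set `S` with closure `G`, if two DISTINCT members `B₁ ≠ B₂` with `|G ∖ cl Bᵢ| = 2` have `S` as their far set
`Bᵢ ∪ (G ∖ cl Bᵢ)`, then no covering preimage of `S` exists — `S ∖ x` is a member for no coloop `x` of `S`.

Proof.  Write `Zᵢ := G ∖ cl Bᵢ` (a 2-set) and `Hᵢ := cl Bᵢ` (rank `4`).  A covering preimage is `B = S ∖ {x}` with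
`x ∈ G ∖ cl B`; `x ∉ Zᵢ` since `S ∖ {x} ⊇ Bᵢ ∪ {z'}` for the other point `z'` of `Zᵢ`, a set of rank `5 > 4`; so
`x ∈ H₁ ∩ H₂`, and `E ∖ B = (E ∖ S) ∪ {x} ⊆ (E ∖ G) ∪ (H₁ ∩ H₂)` (`G ∖ S ⊆ G ∖ Zᵢ = Hᵢ`).  As `Z₁ ≠ Z₂`, some
`z ∈ Z₁ ∖ Z₂ ⊆ H₂`, so `H₁ ∪ H₂ ⊇ B₁ ∪ {z}` has rank `5`, and submodularity gives `ρ(H₁ ∩ H₂) ≤ 4 + 4 − 5 = 3`; hence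
`ρ(E ∖ B) ≤ 3 + |E ∖ G| = 5 < 6`, contradicting `B ∈ Uq`.  ∎   (`coverPreimages_eq_empty_of_two_far`.)

With this lemma the column of the pair-5 rule at a set with `t ≥ 2` far preimages is `t/5 + p₃/25` (no covering
part); the numerics (mining/night-2/g14/tP.py) show `t ≤ 3` and `p₃ ≤ 6` at `t = 3` on every coloop-free flat whose
series classes have ≤ 3 elements — the two facts still to be proved for the general `k = 0` cell.
-/

namespace PercRepro.Shadow

open Finset PerFlat ThmH

variable {α : Type*} [DecidableEq α] {M : Matroid α} [M.Finite]

omit [DecidableEq α] in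
/-- The rank of a finset is at most its cardinality. -/
theorem rkN_le_card_fin (X : Finset α) : rkN M X ≤ X.card := by
  have h := M.eRk_le_encard (X : Set α)
  rw [eRk_eq_rkN, Set.encard_coe_eq_coe_finsetCard] at h
  exact_mod_cast h

/-- `ρ(X ∪ Y) ≤ ρ(X) + |Y|`. -/
theorem rkN_union_le_rkN_add_card (X Y : Finset α) : rkN M (X ∪ Y) ≤ rkN M X + Y.card := by
  have h := M.eRk_union_le_eRk_add_eRk (X : Set α) (Y : Set α)
  rw [← Finset.coe_union, eRk_eq_rkN, eRk_eq_rkN, eRk_eq_rkN] at h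
  have h2 : rkN M (X ∪ Y) ≤ rkN M X + rkN M Y := by exact_mod_cast h
  exact h2.trans (Nat.add_le_add_left (rkN_le_card_fin Y) _)

/-- The closure of a bottom set has rank `q`. -/
theorem rkN_clF_eq_of_mem_Uq {q : ℕ} {B : Finset α} (hB : B ∈ Uq M (q + 2) q) : rkN M (clF M B) = q := by
  unfold rkN
  rw [coe_clF, M.eRk_closure_eq, (mem_Uq.1 hB).2.1]
  rfl

/-- A bottom set has rank `q`. -/
theorem rkN_eq_of_mem_Uq {q : ℕ} {B : Finset α} (hB : B ∈ Uq M (q + 2) q) : rkN M B = q := by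
  unfold rkN
  rw [(mem_Uq.1 hB).2.1]
  rfl

/-- The complement of a bottom set has rank `q + 2`. -/
theorem rkN_sdiff_eq_of_mem_Uq {q : ℕ} {B : Finset α} (hB : B ∈ Uq M (q + 2) q) : rkN M (gr M \ B) = q + 2 := by
  unfold rkN
  rw [(mem_Uq.1 hB).2.2]
  rfl

/-- A covering set `B ∪ {z}` (`z ∈ G ∖ cl B`) of a member below a rank-`(q+1)` flat has rank `q + 1`. -/
theorem rkN_insert_eq_of_mem_sdiff_clF {q : ℕ} {G : Finset α} (hG : G ∈ flatsQ M (q + 1)) {B : Finset α}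
    (hB : B ∈ Uq M (q + 2) q) {z : α} (hz : z ∈ G \ clF M B) : rkN M (insert z B) = q + 1 := by
  have hY := insert_mem_Yq hB ((mem_flatsQ.1 hG).1 (Finset.mem_sdiff.1 hz).1) (Finset.mem_sdiff.1 hz).2
  unfold rkN
  rw [eRk_eq_of_mem_Yq_diag hY]
  rfl

open scoped Classical in
/-- **Two distinct far preimages leave no covering preimage** (`q = 4`, `|E ∖ G| = 2`). -/
theorem coverPreimages_eq_empty_of_two_far {G : Finset α} (hG : G ∈ flatsQ M (4 + 1))
    (hd : (gr M \ G).card = 2) {S : Finset α} {B₁ B₂ : Finset α}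
    (hB₁ : B₁ ∈ membersIn M (Uq M (4 + 2) 4) G) (hB₂ : B₂ ∈ membersIn M (Uq M (4 + 2) 4) G)
    (hm₁ : (G \ clF M B₁).card = 2) (hm₂ : (G \ clF M B₂).card = 2)
    (hS₁ : S = B₁ ∪ (G \ clF M B₁)) (hS₂ : S = B₂ ∪ (G \ clF M B₂)) (hne : B₁ ≠ B₂) :
    coverPreimages M (Uq M (4 + 2) 4) G S = ∅ := by
  have hGg : G ⊆ gr M := (mem_flatsQ.1 hG).1
  have hU₁ : B₁ ∈ Uq M (4 + 2) 4 := (mem_membersIn.1 hB₁).1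
  have hU₂ : B₂ ∈ Uq M (4 + 2) 4 := (mem_membersIn.1 hB₂).1
  have hcl₁ : clF M B₁ ⊆ G := (mem_membersIn.1 hB₁).2
  have hcl₂ : clF M B₂ ⊆ G := (mem_membersIn.1 hB₂).2
  -- the two pairs are distinct
  have hZne : G \ clF M B₁ ≠ G \ clF M B₂ := by
    intro hZ
    apply hne
    have key : ∀ C, C ∈ Uq M (4 + 2) 4 → S = C ∪ (G \ clF M C) → C = S \ (G \ clF M C) := by
      intro C hC hSC
      rw [hSC, Finset.union_sdiff_right]
      symm
      rw [Finset.sdiff_eq_self_iff_disjoint, Finset.disjoint_left]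
      intro e heC he
      exact (Finset.mem_sdiff.1 he).2 (subset_clF hC heC)
    rw [key B₁ hU₁ hS₁, key B₂ hU₂ hS₂, hZ]
  -- a point of `Z₁ ∖ Z₂`, which lies in `H₂`
  obtain ⟨z, hz₁, hz₂⟩ : ∃ z ∈ G \ clF M B₁, z ∉ G \ clF M B₂ := by
    by_contra hcon
    push Not at hcon
    apply hZne
    apply Finset.eq_of_subset_of_card_le hcon
    rw [hm₁, hm₂]
  have hzH₂ : z ∈ clF M B₂ := by
    by_contra h
    exact hz₂ (Finset.mem_sdiff.2 ⟨(Finset.mem_sdiff.1 hz₁).1, h⟩)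
  -- `ρ(H₁ ∪ H₂) ≥ 5`
  have hrU : 5 ≤ rkN M (clF M B₁ ∪ clF M B₂) := by
    have h1 : insert z B₁ ⊆ clF M B₁ ∪ clF M B₂ :=
      Finset.insert_subset (Finset.mem_union_right _ hzH₂) ((subset_clF hU₁).trans Finset.subset_union_left)
    have h2 := rkN_insert_eq_of_mem_sdiff_clF hG hU₁ hz₁
    have := rkN_mono (M := M) h1
    omega
  -- `ρ(H₁ ∩ H₂) ≤ 3` by submodularity
  have hrI : rkN M (clF M B₁ ∩ clF M B₂) ≤ 3 := by
    have hsub := rkN_submod (M := M) (clF M B₁) (clF M B₂)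
    rw [rkN_clF_eq_of_mem_Uq hU₁, rkN_clF_eq_of_mem_Uq hU₂] at hsub
    omega
  -- now a covering preimage is impossible
  rw [Finset.eq_empty_iff_forall_notMem]
  intro B hB
  rw [mem_coverPreimages] at hB
  obtain ⟨hBm, hcov⟩ := hB
  have hBU : B ∈ Uq M (4 + 2) 4 := (mem_membersIn.1 hBm).1
  obtain ⟨x, hx, hxS⟩ := mem_coverSets.1 hcov
  have hxG : x ∈ G := (Finset.mem_sdiff.1 hx).1
  have hxB : x ∉ B := notMem_of_notMem_clF hBU (Finset.mem_sdiff.1 hx).2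
  have hrB : rkN M B = 4 := rkN_eq_of_mem_Uq hBU
  -- `x ∉ Zᵢ`: otherwise `B ⊇ Bᵢ ∪ {z'}` has rank `5`
  have hxZ : ∀ C, C ∈ Uq M (4 + 2) 4 → (G \ clF M C).card = 2 → S = C ∪ (G \ clF M C) → x ∉ G \ clF M C := by
    intro C hC hmC hSC hxC
    obtain ⟨a, b, hab, hZ⟩ := Finset.card_eq_two.1 hmC
    have hxab : x = a ∨ x = b := by
      rw [hZ, Finset.mem_insert, Finset.mem_singleton] at hxC
      exact hxC
    -- the other point `z'` of the pair
    obtain ⟨z', hz'Z, hz'x⟩ : ∃ z' ∈ G \ clF M C, z' ≠ x := by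
      rcases hxab with rfl | rfl
      · exact ⟨b, by rw [hZ]; simp, hab.symm⟩
      · exact ⟨a, by rw [hZ]; simp, hab⟩
    have hsub : insert z' C ⊆ B := by
      intro e he
      rw [Finset.mem_insert] at he
      have heS : e ∈ S := by
        rw [hSC]
        rcases he with rfl | he
        · exact Finset.mem_union_right _ hz'Z
        · exact Finset.mem_union_left _ he
      rw [← hxS, Finset.mem_insert] at heS
      rcases heS with rfl | heB
      · exfalso
        rcases he with rfl | he
        · exact hz'x rfl
        · exact (Finset.mem_sdiff.1 hxC).2 (subset_clF hC he)
      · exact heB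
    have h5 := rkN_insert_eq_of_mem_sdiff_clF hG hC hz'Z
    have := rkN_mono (M := M) hsub
    omega
  have hxH₁ : x ∈ clF M B₁ := by
    by_contra h
    exact hxZ B₁ hU₁ hm₁ hS₁ (Finset.mem_sdiff.2 ⟨hxG, h⟩)
  have hxH₂ : x ∈ clF M B₂ := by
    by_contra h
    exact hxZ B₂ hU₂ hm₂ hS₂ (Finset.mem_sdiff.2 ⟨hxG, h⟩)
  -- `E ∖ B ⊆ (H₁ ∩ H₂) ∪ (E ∖ G)`
  have hcompl : gr M \ B ⊆ (clF M B₁ ∩ clF M B₂) ∪ (gr M \ G) := by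
    intro e he
    rw [Finset.mem_sdiff] at he
    rw [Finset.mem_union, Finset.mem_inter, Finset.mem_sdiff]
    by_cases heG : e ∈ G
    · left
      by_cases hex : e = x
      · subst hex; exact ⟨hxH₁, hxH₂⟩
      · have heS : e ∉ S := by
          intro heS
          rw [← hxS, Finset.mem_insert] at heS
          rcases heS with h | h
          · exact hex h
          · exact he.2 h
        constructor
        · by_contra h
          exact heS (by rw [hS₁]; exact Finset.mem_union_right _ (Finset.mem_sdiff.2 ⟨heG, h⟩))
        · by_contra h
          exact heS (by rw [hS₂]; exact Finset.mem_union_right _ (Finset.mem_sdiff.2 ⟨heG, h⟩))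
    · right
      exact ⟨he.1, heG⟩
  have h6 := rkN_sdiff_eq_of_mem_Uq hBU
  have h1 := rkN_mono (M := M) hcompl
  have h2 := rkN_union_le_rkN_add_card (M := M) (clF M B₁ ∩ clF M B₂) (gr M \ G)
  rw [hd] at h2
  omega

end PercRepro.Shadow
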